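import Mathlib
import Summits.NavierStokesRegularity.NavierStokesRegularity.Theorems.EulerZoomLiouvillePowerGaugeEulerLiouvilleKelvinPhysicalCompactVorticity
import Summits.NavierStokesRegularity.NavierStokesRegularity.Theorems.EulerZoomLiouvillePowerGaugeEulerLiouvilleDSSCompactVorticity
import HarnessLib.Audit

/-!
# Crux `EulerZoomLiouville.PowerGaugeEulerLiouville`: CLASSICAL ENERGY-CONCENTRATING MEMBERS ARE
# TRIVIAL (a stratum of `stub_nonSelfSimilar` and of the endpoint of `stub_selfSimilarExtremal`)

Route №10 `EulerZoomLiouville` (NavierStokesRegularity), crux E = stmt-NavierStokesRegularity-19832,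
skeleton v10 (line `birth`).  MEMBER LEVEL.  Let `(u, p, H, c)` satisfy the three hypotheses of the
crux at exponent `ρ > 0`, with `(u, p)` classical on the past and, in the similarity scaling
`x ~ (−τ)^γ`, `γ = 1/(2+ρ)`:
(a) `‖u(τ,x)‖ ≤ M(−τ)^{γ−1}`, (d) `‖∇u(τ,x)‖ ≤ K/(−τ)` (Type I in the sense of Chae–Wolf (1.2)),
(b) `(−τ)‖∇u(τ,x)‖ → 0` in the far field `|x|(−τ)^{−γ} → ∞`,
(c) `∫_{|x|≥r}|u(τ)|² ≤ C r^{−β}(−τ)^{γβ}` for `r ≥ R₀(−τ)^γ`, some `β > 0`, `u(τ) ∈ L²`.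

* `isUniformlyLipschitzOn_of_typeI` — (d) gives the Cauchy–Lipschitz hypotheses on `(−∞, 0)`;
* `ae_eq_zero_of_gauge_of_concentrating` — **THE STRATUM**: such a member vanishes a.e.  Proof:
  Kelvin at spatial infinity (`…KelvinPhysical*`) ⇒ `curl u(τ) = 0` off `B(0, c₀(−τ)^γ)` at every
  time ⇒ the support volume of the vorticity, conserved in time
  (`IsVorticitySolutionOn.volume_support_vorticity_eq`), is at most `vol B(0, c₀(−τ₂)^γ) → 0`
  (`τ₂ → 0⁻`) ⇒ irrotational ⇒ `ae_eq_zero_of_gauge_of_irrotational` (the tail of the tree's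
  `dss_ae_eq_zero_of_compactSupport_vorticity`).

WHERE IT SITS.  No self-similarity is assumed: the statement covers exactly self-similar members
with classical bounded profiles (there (a)–(d) are automatic from `V, DV` bounded, `DV → 0`,
`V ∈ L²` with shell decay — cf. `…SelfSimilarEndpointSmooth`), discretely self-similar ones
(Chae–Wolf 2020 Cor. 1.5, the tree's FACT `chaeWolf2020_dss_energyConservingScale`, whose
hypothesis `L^∞ W^{1,∞}` + Type I is (a)+(d); (b)–(c) are the extra far-field/tail inputs of this
route), and non-self-similar energy concentration at the similarity rate (Chae–Wolf Thm 3.1's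
scenario).  It is a stratum of the registered residue `stub_nonSelfSimilar` (classical members
concentrating at the class rate) — the first classical stratum of that stub beyond DSS.

WHAT THIS IS NOT: not NS, not E, not the stubs — weak-class members, and classical members whose
far-field gradient is not `o((−τ)^{−1})` or whose tail energy does not decay at a power rate in the
similarity scaling, are untouched.

## References

* D. Chae, J. Wolf, Comm. Math. Phys. 376 (2020) = arXiv:1706.02020, Thm 1.1, Cor. 1.5, Thm 3.1, §3.4.
  [ChaeWolf2020EulerTypeI]
* A. J. Majda, A. L. Bertozzi, *Vorticity and Incompressible Flow*, CUP 2002, §1.6 Props. 1.8, 1.11.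
  [MajdaBertozziCUP2002]
-/

noncomputable section

-- flat `Theorems/<Route><Decl>…` files of one crux share the namespace of the crux (tree convention)
set_option linter.dupNamespace false

open MeasureTheory Set Filter Topology Metric Function InnerProductSpace
open scoped RealInnerProductSpace NNReal ENNReal ContDiff

namespace Summit.NavierStokesRegularity.NavierStokesRegularity.Theorems.PowerGaugeEulerLiouville.KelvinPhysical

open Literature.Analysis Literature.Analysis.FunctionSpaces Literature.Analysis.FluidPDE

variable {u : ℝ → EuclideanSpace ℝ (Fin 3) → EuclideanSpace ℝ (Fin 3)}
  {p : ℝ → EuclideanSpace ℝ (Fin 3) → ℝ}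

/-! ### Member-level strata: classical energy-concentrating members are trivial -/

/-- **Type-I gradient bound ⇒ Cauchy–Lipschitz hypotheses on the past**: if
`‖∇u(τ, x)‖ ≤ K/(−τ)` for `τ < 0` then the gradient is bounded on every compact set of negative
times, so the particle trajectories exist (`ODE.IsUniformlyLipschitzOn u (Iio 0)`).
[cite: MajdaBertozziCUP2002, §4.2 proof of Thm. 4.3 (bounded gradient ⇒ trajectories)] -/
theorem isUniformlyLipschitzOn_of_typeI (hu : IsSmoothSpaceTimeOn (Iio 0) u) {K : ℝ}
    (hK : ∀ τ : ℝ, τ < 0 → ∀ x, ‖fderiv ℝ (u τ) x‖ ≤ K / (-τ)) :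
    ODE.IsUniformlyLipschitzOn u (Iio 0) := by
  refine hu.isUniformlyLipschitzOn_of_norm_fderiv_le fun C hC hCS => ?_
  rcases C.eq_empty_or_nonempty with rfl | hne
  · exact ⟨0, fun t ht => absurd ht (notMem_empty t)⟩
  obtain ⟨t₁, ht₁C, ht₁⟩ := hC.exists_isMaxOn hne continuous_id.continuousOn
  have ht₁0 : t₁ < 0 := hCS ht₁C
  have hK0 : 0 ≤ K := by
    have h := hK t₁ ht₁0 0
    have : 0 ≤ K / (-t₁) := (norm_nonneg _).trans h
    exact (div_nonneg_iff.1 this).elim (fun h => h.1) fun h => absurd h.2 (not_le.2 (by linarith))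
  refine ⟨K / (-t₁), fun t ht x => (hK t (hCS ht) x).trans ?_⟩
  have htt₁ : t ≤ t₁ := ht₁ ht
  exact div_le_div_of_nonneg_left hK0 (by linarith) (by linarith)

/-- **THE CLASSICAL ENERGY-CONCENTRATING STRATUM of the crux (both open stubs at once).**  Let
`(u, p, H, c)` satisfy the three hypotheses of `PowerGaugeEulerLiouville` at exponent `ρ > 0`,
with `(u, p)` CLASSICAL on the past (`IsClassicalEulerSolutionOn (Iio 0) 0 u p`) and, in the
similarity scaling `x ~ (−τ)^γ`, `γ = 1/(2+ρ)`, of the class: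
(a) `‖u(τ,x)‖ ≤ M(−τ)^{γ−1}`, (d) `‖∇u(τ,x)‖ ≤ K/(−τ)` (Type I),
(b) `∇u(τ,x)(−τ) → 0` in the far field `‖x‖(−τ)^{−γ} → ∞` (in the `∀ ε ∃ R` form),
(c) `∫_{|x|≥r}|u(τ)|² ≤ C r^{−β}(−τ)^{γβ}` for `r ≥ R₀(−τ)^γ`, some `β > 0`, and `u(τ) ∈ L²`.
Then `u = 0` a.e. on the slab.  No self-similarity of any kind is assumed (exactly self-similar
and discretely self-similar classical members with bounded profiles are the model cases).
Proof: Kelvin at spatial infinity makes `curl u(τ)` vanish outside the ball of radius `c₀(−τ)^γ`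
(`curl_eq_zero_of_far`); the support volume of the vorticity is conserved
(`IsVorticitySolutionOn.volume_support_vorticity_eq`) but bounded by `vol B(0, c₀(−τ₂)^γ) → 0`
as `τ₂ → 0⁻`, so the flow is irrotational, and the irrotational stratum
(`ae_eq_zero_of_gauge_of_irrotational`) concludes.  This is the mechanism of Chae–Wolf, CMP 376
(2020), Thm 3.1/§3.4 (one-point energy concentration under Type I), with their local-pressure
decay estimates replaced by the hypotheses (b)–(c) and Kelvin's theorem.
[cite: ChaeWolf2020EulerTypeI, Thm 1.1, Thm 3.1, §3.4; MajdaBertozziCUP2002, §1.6 Props. 1.8, 1.11] -/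
theorem ae_eq_zero_of_gauge_of_concentrating {ρ : ℝ} (hρ : 0 < ρ)
    {H : ℝ → EuclideanSpace ℝ (Fin 3) → EuclideanSpace ℝ (Fin 3) →L[ℝ] EuclideanSpace ℝ (Fin 3)}
    {c : ℝ≥0}
    (hsw : IsSuitableWeakSolutionOn (slab (EuclideanSpace ℝ (Fin 3)) (Iio 0) isOpen_Iio) 0 0 u p)
    (hH : HasWeakSpatialGradientOn (slab (EuclideanSpace ℝ (Fin 3)) (Iio 0) isOpen_Iio) u H)
    (hgauge : ∀ a : ℝ, 0 < a →
      ENNReal.ofReal (a ^ (2 * ρ)) * cknA a (0 : ℝ × EuclideanSpace ℝ (Fin 3)) u +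
          ENNReal.ofReal (a ^ ρ) * cknE a (0 : ℝ × EuclideanSpace ℝ (Fin 3)) H +
        ENNReal.ofReal (a ^ (2 * ρ)) * cknD a (0 : ℝ × EuclideanSpace ℝ (Fin 3)) p ≤ (c : ℝ≥0∞))
    (hcl : IsClassicalEulerSolutionOn (Iio 0) 0 u p)
    {M : ℝ} (hM : ∀ τ : ℝ, τ < 0 → ∀ x, ‖u τ x‖ ≤ M * (-τ) ^ (1 / (2 + ρ) - 1))
    {K : ℝ} (hK : ∀ τ : ℝ, τ < 0 → ∀ x, ‖fderiv ℝ (u τ) x‖ ≤ K / (-τ))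
    (hfar : ∀ ε : ℝ, 0 < ε → ∃ R : ℝ, 0 ≤ R ∧ ∀ τ : ℝ, τ < 0 → ∀ x : EuclideanSpace ℝ (Fin 3),
      R * (-τ) ^ (1 / (2 + ρ)) ≤ ‖x‖ → ‖fderiv ℝ (u τ) x‖ ≤ ε / (-τ))
    {β C R₀ : ℝ} (hβ : 0 < β) (hR₀ : 0 ≤ R₀)
    (htail : ∀ τ : ℝ, τ < 0 → ∀ r : ℝ, R₀ * (-τ) ^ (1 / (2 + ρ)) ≤ r →
      ∫ x in {x | r ≤ ‖x‖}, ‖u τ x‖ ^ 2 ≤ C * r ^ (-β) * (-τ) ^ (1 / (2 + ρ) * β))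
    (hu2 : ∀ τ : ℝ, τ < 0 → Integrable (fun x => ‖u τ x‖ ^ 2) volume) :
    uncurry u =ᵐ[volume.restrict (Iio (0 : ℝ) ×ˢ (univ : Set (EuclideanSpace ℝ (Fin 3))))] 0 := by
  set γ : ℝ := 1 / (2 + ρ) with hγ
  have hγ0 : 0 < γ := by rw [hγ]; positivity
  have hL : ODE.IsUniformlyLipschitzOn u (Iio 0) := isUniformlyLipschitzOn_of_typeI hcl.smooth_velocity hK
  -- the far field: `ε = γβ/4`
  obtain ⟨R, hR, hfarR⟩ := hfar (γ * β / 4) (by positivity)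
  have hrate : γ * β / 4 < γ * β / 2 := by nlinarith
  set c₀ : ℝ := max R R₀ + |M| / γ + 1 with hc₀
  have hc₀0 : 0 < c₀ := by rw [hc₀]; positivity
  -- (i) the vorticity vanishes outside the ball of radius `c₀ (−τ)^γ`, at every time
  have hcurl : ∀ τ : ℝ, τ < 0 → ∀ x : EuclideanSpace ℝ (Fin 3), c₀ * (-τ) ^ γ < ‖x‖ →
      curl (u τ) x = 0 := fun τ hτ x hx =>
    curl_eq_zero_of_far hcl hL hγ0 hM hR hfarR hR₀ htail hu2 hrate hτ hx
  -- (ii) the support volume at time `τ₁` is at most `vol B(0, c₀(−τ₂)^γ)` for every later `τ₂`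
  have hV : IsVorticitySolutionOn (Iio 0) 0 u :=
    hcl.isVorticitySolutionOn_of_isOpen isOpen_Iio fun t _ x => curl_fun_zero x
  have hvolle : ∀ τ₁ τ₂ : ℝ, τ₁ ≤ τ₂ → τ₂ < 0 →
      volume {x | vorticity u τ₁ x ≠ 0} ≤
        volume (closedBall (0 : EuclideanSpace ℝ (Fin 3)) (c₀ * (-τ₂) ^ γ)) := by
    intro τ₁ τ₂ h12 hτ₂
    have hsuppK : ∀ σ ∈ Icc τ₁ τ₂, ∀ x ∉ closedBall (0 : EuclideanSpace ℝ (Fin 3)) (c₀ * (-τ₁) ^ γ),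
        vorticity u σ x = 0 := by
      intro σ hσ x hx
      have hσ0 : σ < 0 := lt_of_le_of_lt hσ.2 hτ₂
      rw [mem_closedBall_zero_iff, not_le] at hx
      have hmono : c₀ * (-σ) ^ γ ≤ c₀ * (-τ₁) ^ γ :=
        mul_le_mul_of_nonneg_left (Real.rpow_le_rpow (by linarith) (by linarith [hσ.1]) hγ0.le) hc₀0.le
      rw [vorticity_apply]
      exact hcurl σ hσ0 x (lt_of_le_of_lt hmono hx)
    rw [← hV.volume_support_vorticity_eq isOpen_Iio h12 (fun σ hσ => lt_of_le_of_lt hσ.2 hτ₂)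
      (isCompact_closedBall _ _) hsuppK]
    refine measure_mono fun x hx => ?_
    by_contra hxB
    rw [mem_closedBall_zero_iff, not_le] at hxB
    exact hx (by rw [vorticity_apply]; exact hcurl τ₂ hτ₂ x hxB)
  -- (iii) hence the support volume vanishes: `vol B(0, c₀(−τ₂)^γ) → 0` as `τ₂ → 0⁻`
  have hvol0 : ∀ τ₁ : ℝ, τ₁ < 0 → volume {x | vorticity u τ₁ x ≠ 0} = 0 := by
    intro τ₁ hτ₁
    by_contra hne
    have hpos : 0 < volume {x | vorticity u τ₁ x ≠ 0} := pos_iff_ne_zero.2 hne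
    -- radii `r ↓ 0` are realised by times `τ₂ = −(r/c₀)^{1/γ} ↑ 0`
    have hball : Tendsto (fun r : ℝ => volume (closedBall (0 : EuclideanSpace ℝ (Fin 3)) r))
        (𝓝[>] 0) (𝓝 0) := by
      have h := tendsto_measure_cthickening_of_isCompact (μ := (volume : Measure (EuclideanSpace ℝ (Fin 3))))
        (isCompact_singleton (x := (0 : EuclideanSpace ℝ (Fin 3))))
      rw [measure_singleton] at h
      refine (h.mono_left nhdsWithin_le_nhds).congr' ?_
      filter_upwards [self_mem_nhdsWithin] with r hr
      rw [cthickening_singleton _ (le_of_lt hr)]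
    obtain ⟨r, hr1, hr2⟩ := ((hball.eventually (gt_mem_nhds hpos)).and
      (self_mem_nhdsWithin : Ioi (0 : ℝ) ∈ 𝓝[>] (0 : ℝ))).exists
    -- the time `τ₂` with `c₀ (−τ₂)^γ = r`, capped at `τ₁`
    set s : ℝ := (r / c₀) ^ (1 / γ) with hs
    have hs0 : 0 < s := Real.rpow_pos_of_pos (div_pos hr2 hc₀0) _
    set τ₂ : ℝ := -min (-τ₁) s with hτ₂
    have hτ₂0 : τ₂ < 0 := by rw [hτ₂]; exact neg_neg_of_pos (lt_min (by linarith) hs0)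
    have h12 : τ₁ ≤ τ₂ := by rw [hτ₂]; linarith [min_le_left (-τ₁) s]
    have hle := hvolle τ₁ τ₂ h12 hτ₂0
    have hrad : c₀ * (-τ₂) ^ γ ≤ r := by
      have h1 : -τ₂ ≤ s := by rw [hτ₂, neg_neg]; exact min_le_right _ _
      have h2 : (-τ₂) ^ γ ≤ s ^ γ := Real.rpow_le_rpow (by linarith) h1 hγ0.le
      have h3 : s ^ γ = r / c₀ := by
        rw [hs, ← Real.rpow_mul (div_pos hr2 hc₀0).le, one_div_mul_cancel hγ0.ne', Real.rpow_one]
      calc c₀ * (-τ₂) ^ γ ≤ c₀ * (r / c₀) := by rw [← h3]; exact mul_le_mul_of_nonneg_left h2 hc₀0.le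
        _ = r := mul_div_cancel₀ r hc₀0.ne'
    have hle' := hle.trans (measure_mono (closedBall_subset_closedBall hrad))
    exact absurd (hr1.trans_le hle') (lt_irrefl _)
  have hcurl0 : ∀ τ : ℝ, τ < 0 → ∀ x, curl (u τ) x = 0 := by
    intro τ hτ x
    have hu1 : ContDiff ℝ 1 (u τ) := (hcl.contDiff_velocity hτ).of_le (mod_cast le_top)
    have hcont : Continuous (curl (u τ)) := (contDiff_curl (n := 0) (by simpa using hu1)).continuous
    have hopen : IsOpen {x | curl (u τ) x ≠ 0} := isOpen_ne_fun hcont continuous_const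
    by_contra hx
    have hpos := hopen.measure_pos volume ⟨x, hx⟩
    have h0 := hvol0 τ hτ
    simp only [vorticity_apply] at h0
    exact hpos.ne' h0
  -- (iv) irrotational classical members are trivial (the tail of `dss_ae_eq_zero_of_compactSupport_vorticity`)
  have h1 := ae_hasWeakGradient_slice_of_slab hH
  have h2 : ∀ᵐ t ∂(volume.restrict (Iio (0 : ℝ))),
      (fun x => H t x) =ᵐ[volume] fun x => fderiv ℝ (u t) x := by
    filter_upwards [h1, ae_restrict_mem measurableSet_Iio] with t ht htneg
    have hcl1 : ContDiff ℝ 1 (u t) := (hcl.contDiff_velocity htneg).of_le (by exact_mod_cast le_top)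
    have hw : HasWeakGradient (u t) (fderiv ℝ (u t)) := hasWeakGradient_fderiv_of_contDiff hcl1
    have := HasWeakFDerivOn.unique_holds ht hw
    rwa [TopologicalSpace.Opens.coe_top, Measure.restrict_univ] at this
  have hμ : (volume : Measure (ℝ × EuclideanSpace ℝ (Fin 3))).restrict
      (Iio (0 : ℝ) ×ˢ (univ : Set (EuclideanSpace ℝ (Fin 3)))) =
      (volume.restrict (Iio (0 : ℝ))).prod (volume : Measure (EuclideanSpace ℝ (Fin 3))) := by
    rw [Measure.volume_eq_prod, Measure.restrict_prod_eq_prod_univ]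
  have hHm : AEStronglyMeasurable (uncurry H)
      ((volume.restrict (Iio (0 : ℝ))).prod (volume : Measure (EuclideanSpace ℝ (Fin 3)))) := by
    have := hH.locallyIntegrableOn_grad.aestronglyMeasurable
    rw [← hμ]; simpa [slab] using this
  have hGcont : ContinuousOn (uncurry fun t x => fderiv ℝ (u t) x)
      (Iio (0 : ℝ) ×ˢ (univ : Set (EuclideanSpace ℝ (Fin 3)))) :=
    (hcl.smooth_velocity.fderiv_slice isOpen_Iio.uniqueDiffOn).continuousOn
  have hGm : AEStronglyMeasurable (uncurry fun t x => fderiv ℝ (u t) x)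
      ((volume.restrict (Iio (0 : ℝ))).prod (volume : Measure (EuclideanSpace ℝ (Fin 3)))) := by
    rw [← hμ]
    exact hGcont.aestronglyMeasurable (measurableSet_Iio.prod MeasurableSet.univ)
  have hHG : uncurry H =ᵐ[(volume.restrict (Iio (0 : ℝ))).prod volume]
      uncurry fun t x => fderiv ℝ (u t) x :=
    ae_eq_prod_of_ae_ae_eq hHm hGm h2
  have hsym : ∀ᵐ z ∂(volume.restrict (Iio (0 : ℝ) ×ˢ (univ : Set (EuclideanSpace ℝ (Fin 3))))),
      ∀ v w : EuclideanSpace ℝ (Fin 3), ⟪H z.1 z.2 v, w⟫ = ⟪H z.1 z.2 w, v⟫ := by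
    rw [hμ]
    have hmem : ∀ᵐ z ∂((volume.restrict (Iio (0 : ℝ))).prod
        (volume : Measure (EuclideanSpace ℝ (Fin 3)))), z.1 < 0 := by
      rw [← hμ]
      filter_upwards [ae_restrict_mem (measurableSet_Iio.prod MeasurableSet.univ)] with z hz
      exact hz.1
    filter_upwards [hHG, hmem] with z hz hzneg v w
    have e : H z.1 z.2 = fderiv ℝ (u z.1) z.2 := hz
    rw [e]
    exact inner_fderiv_comm_of_curl_eq_zero
      (((hcl.contDiff_velocity hzneg).differentiable (by simp)) z.2) (hcurl0 z.1 hzneg z.2) v w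
  exact ae_eq_zero_of_gauge_of_irrotational (by linarith) hsw hH hgauge hsym

end Summit.NavierStokesRegularity.NavierStokesRegularity.Theorems.PowerGaugeEulerLiouville.KelvinPhysical

end
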